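import Literature.AlgebraicGeometry.Motives.MixedHodgeExtensionBiproduct
import Literature.AlgebraicGeometry.Motives.MixedHodgeStructureInternalHomProd
import Literature.AlgebraicGeometry.Motives.MixedHodgeExtensionHomFunctor
import Literature.AlgebraicGeometry.Motives.MixedHodgeExtensionTensorTate
import HarnessLib

/-!
# `Hom(C₁ ⊕ C₂, E)`, `Hom(E, C₁ ⊕ C₂)`, `(C₁ ⊕ C₂) ⊗ E`, `E ⊗ (C₁ ⊕ C₂)`: additivity of the Hom and tensor functors of extensions in the mixed Hodge structure `C`

For an extension `E : 0 → B → E → A → 0` of mixed `ℚ`-Hodge structures and a further MHS `C`, the tree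
has the extensions `Hom(C, E)` (`Extension.homLeft`), `Hom(E, C)` (`homRight`), `E ⊗ C` (`rTensor`),
`C ⊗ E` (`lTensor`) and the induced maps `Ext.homLeftMap C`, `homRightMap C`, `rTensorMap C`,
`lTensorMap C` on congruence classes (Deligne, *Théorie de Hodge II*, 1.1.12: `Hom`, `⊗` are functors
of bifiltered objects; Jannsen, *Mixed Motives*, LNM 1400, §9 Remark 9.3 a); Carlson 1980, §2(c)
Remark (3)). Mac Lane, *Homology* (1963), Ch. I (6.5) and Ch. V (1.6): `Hom` and `⊗` are additive, so
`Hom(A₁ ⊕ A₂, B) ≅ Hom(A₁, B) ⊕ Hom(A₂, B)`, `Hom(A, B₁ ⊕ B₂) ≅ Hom(A, B₁) ⊕ Hom(A, B₂)`,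
`G ⊗ (A ⊕ B) ≅ (G ⊗ A) ⊕ (G ⊗ B)` — for MHS these are the isomorphisms of
`MixedHodgeStructureInternalHomProd.lean` — and Ch. III (2.3) defines the direct sum `E₁ ⊕ E₂` of two
extensions. Applying the isomorphisms termwise to `Hom(C₁ ⊕ C₂, E)` etc. gives MORPHISMS OF EXTENSIONS
onto the direct sums `Hom(C₁, E) ⊕ Hom(C₂, E)` etc. whose three components are isomorphisms, hence
(Mac Lane III Prop. 1.8) the classes correspond under transport along these isomorphisms. This file:

* §0 transport of structure: `f^*`, `g_*` along bijective morphisms are bijections of `Ext`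
  (`Ext.pullbackMapW_bijective_of_bijective`, `pushoutMapW_bijective_of_bijective`), a morphism of
  extensions with bijective outer components identifies split extensions
  (`Morphism.isSplit_iff_of_bijective`); `Hom.prodMap_id`.
* §1 **`Ext.prodW x₁ x₂ := (ι₁)_* π₁^* x₁ + (ι₂)_* π₂^* x₂ ∈ Ext(A₁ ⊕ A₂, B₁ ⊕ B₂)`** — the direct sum
  of CLASSES (Mac Lane III (2.3) on `Ext`): `prodW [E₁] [E₂] = [E₁ ⊕ E₂]`, its four coordinates,
  additivity, naturality `(g₁ ⊕ g₂)_* prodW = prodW (g₁_*, g₂_*)`, `(f₁ ⊕ f₂)^* prodW = prodW (f₁^*, f₂^*)`.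
* §2 **`Extension.homLeftProdMorphism E C₁ C₂ : Hom(C₁ ⊕ C₂, E) → Hom(C₁, E) ⊕ Hom(C₂, E)`** over
  `(homProdLeftTo C₁ C₂ B, ·, homProdLeftTo C₁ C₂ A)`, hence
  **`(≅)_* Hom(C₁ ⊕ C₂, x) = (≅)^* prodW (Hom(C₁, x), Hom(C₂, x))`** (`Ext.pushoutMapW_homLeftMap_prod`),
  the solved forms in both directions, the congruence, and
  `Hom(C₁ ⊕ C₂, E)` splits iff `Hom(C₁, E)` and `Hom(C₂, E)` split.
* §3 the same for **`Hom(E, C₁ ⊕ C₂) → Hom(E, C₁) ⊕ Hom(E, C₂)`** (`homRightProdMorphism`, `homRightMap`).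
* §4 the same for **`E ⊗ (C₁ ⊕ C₂) → (E ⊗ C₁) ⊕ (E ⊗ C₂)`** (`rTensorProdMorphism`, `rTensorMap`) and
  **`(C₁ ⊕ C₂) ⊗ E → (C₁ ⊗ E) ⊕ (C₂ ⊗ E)`** (`lTensorProdMorphism`, `lTensorMap`).

All statements proved; definitions with bodies; no named facts.

## References

* [MacLane1963Homology] S. Mac Lane, Homology, Grundlehren 114, Springer (1963), Ch. I (6.5), Ch. III
  (2.3), Prop. 1.8, Thm. 2.1, Ch. V (1.6) (held text `book:mac-lane1963-homology`, PDF pp. 38–39,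
  87–91, 166).
* [DeligneHodgeII1971] P. Deligne, Théorie de Hodge II, Publ. Math. IHÉS 40 (1971), 1.1.12, Thm. 2.3.5.
* [Jannsen1990MixedMotives] U. Jannsen, Mixed Motives and Algebraic K-Theory, LNM 1400 (1990), §9
  Remark 9.3 a).
* [Carlson1980] J. A. Carlson, Extensions of mixed Hodge structures (1980), §2(b) Prop. 1 and Remark,
  §2(c) Remark (3).
-/

noncomputable section

open scoped TensorProduct

namespace Literature.AlgebraicGeometry.Motives

namespace MixedHodgeStructure

universe u v w x₁ x₂

variable {VA : Type u} [AddCommGroup VA] [Module ℚ VA] [FiniteDimensional ℚ VA]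
variable {VB : Type v} [AddCommGroup VB] [Module ℚ VB] [FiniteDimensional ℚ VB]
variable {VE : Type w} [AddCommGroup VE] [Module ℚ VE] [FiniteDimensional ℚ VE]
variable {VC₁ : Type x₁} [AddCommGroup VC₁] [Module ℚ VC₁] [FiniteDimensional ℚ VC₁]
variable {VC₂ : Type x₂} [AddCommGroup VC₂] [Module ℚ VC₂] [FiniteDimensional ℚ VC₂]

/-! ### §0 Transport of structure along isomorphisms; `1 ⊕ 1 = 1` -/

section Transport

variable {VA' VB' : Type*} [AddCommGroup VA'] [Module ℚ VA'] [AddCommGroup VB'] [Module ℚ VB']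
variable {A : MixedHodgeStructure VA} {B : MixedHodgeStructure VB}
variable {A' : MixedHodgeStructure VA'} {B' : MixedHodgeStructure VB'}

omit [FiniteDimensional ℚ VA] [FiniteDimensional ℚ VB] in
/-- `1_{H₁} ⊕ 1_{H₂} = 1_{H₁ ⊕ H₂}`. [cite: MacLane1963Homology, Ch. I (4.2)] -/
theorem Hom.prodMap_id (H₁ : MixedHodgeStructure VA) (H₂ : MixedHodgeStructure VB) :
    Hom.prodMap (Hom.id H₁) (Hom.id H₂) = Hom.id (H₁.prod H₂) :=
  Hom.ext (by rw [Hom.prodMap_toLinearMap, Hom.id_toLinearMap, Hom.id_toLinearMap, Hom.id_toLinearMap,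
    LinearMap.prodMap_id])

namespace Ext

omit [FiniteDimensional ℚ VA] [FiniteDimensional ℚ VB] in
/-- `g⁻¹_* g_* x = x` for a bijective morphism `g`. [cite: MacLane1963Homology, Ch. III (1.4')] -/
theorem pushoutMapW_inverse_pushoutMapW (g : Hom B B') (hg : Function.Bijective g.toLinearMap) (x : Ext A B) :
    pushoutMapW (g.inverse hg) (pushoutMapW g x) = x := by
  rw [← pushoutMapW_comp, Hom.inverse_comp, pushoutMapW_id]

omit [FiniteDimensional ℚ VA] [FiniteDimensional ℚ VB] in
/-- `g_* g⁻¹_* y = y` for a bijective morphism `g`. [cite: MacLane1963Homology, Ch. III (1.4')] -/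
theorem pushoutMapW_pushoutMapW_inverse (g : Hom B B') (hg : Function.Bijective g.toLinearMap) (y : Ext A B') :
    pushoutMapW g (pushoutMapW (g.inverse hg) y) = y := by
  rw [← pushoutMapW_comp, Hom.comp_inverse, pushoutMapW_id]

omit [FiniteDimensional ℚ VA] [FiniteDimensional ℚ VB] in
/-- `f⁻¹^* f^* x = x` for a bijective morphism `f : A' → A` (note `f^* : Ext(A, B) → Ext(A', B)`).
[cite: MacLane1963Homology, Ch. III (1.2)] -/
theorem pullbackMapW_inverse_pullbackMapW (f : Hom A' A) (hf : Function.Bijective f.toLinearMap) (x : Ext A B) :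
    pullbackMapW (f.inverse hf) (pullbackMapW f x) = x := by
  rw [← pullbackMapW_comp, Hom.comp_inverse, pullbackMapW_id]

omit [FiniteDimensional ℚ VA] [FiniteDimensional ℚ VB] in
/-- `f^* f⁻¹^* y = y` for a bijective morphism `f : A' → A`. [cite: MacLane1963Homology, Ch. III (1.2)] -/
theorem pullbackMapW_pullbackMapW_inverse (f : Hom A' A) (hf : Function.Bijective f.toLinearMap) (y : Ext A' B) :
    pullbackMapW f (pullbackMapW (f.inverse hf) y) = y := by
  rw [← pullbackMapW_comp, Hom.inverse_comp, pullbackMapW_id]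

omit [FiniteDimensional ℚ VA] [FiniteDimensional ℚ VB] in
/-- **Transport of structure**: `g_* : Ext(A, B) → Ext(A, B')` is a bijection for an isomorphism `g`.
[cite: MacLane1963Homology, Ch. III Thm. 2.1] -/
theorem pushoutMapW_bijective_of_bijective (g : Hom B B') (hg : Function.Bijective g.toLinearMap) :
    Function.Bijective (pushoutMapW (A := A) g) :=
  Function.bijective_iff_has_inverse.2 ⟨pushoutMapW (g.inverse hg),
    pushoutMapW_inverse_pushoutMapW g hg, pushoutMapW_pushoutMapW_inverse g hg⟩

omit [FiniteDimensional ℚ VA] [FiniteDimensional ℚ VB] in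
/-- **Transport of structure**: `f^* : Ext(A, B) → Ext(A', B)` is a bijection for an isomorphism `f`.
[cite: MacLane1963Homology, Ch. III Thm. 2.1] -/
theorem pullbackMapW_bijective_of_bijective (f : Hom A' A) (hf : Function.Bijective f.toLinearMap) :
    Function.Bijective (pullbackMapW (B := B) f) :=
  Function.bijective_iff_has_inverse.2 ⟨pullbackMapW (f.inverse hf),
    pullbackMapW_inverse_pullbackMapW f hf, pullbackMapW_pullbackMapW_inverse f hf⟩

omit [FiniteDimensional ℚ VA] [FiniteDimensional ℚ VB] in
/-- `g_* x = 0 ↔ x = 0` for an isomorphism `g`. [cite: MacLane1963Homology, Ch. III Thm. 2.1] -/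
theorem pushoutMapW_eq_zeroW_iff_of_bijective (g : Hom B B') (hg : Function.Bijective g.toLinearMap)
    (x : Ext A B) : pushoutMapW g x = zeroW ↔ x = zeroW := by
  rw [← pushoutMapW_zeroW g, (pushoutMapW_bijective_of_bijective g hg).1.eq_iff]

omit [FiniteDimensional ℚ VA] [FiniteDimensional ℚ VB] in
/-- `f^* x = 0 ↔ x = 0` for an isomorphism `f`. [cite: MacLane1963Homology, Ch. III Thm. 2.1] -/
theorem pullbackMapW_eq_zeroW_iff_of_bijective (f : Hom A' A) (hf : Function.Bijective f.toLinearMap)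
    (x : Ext A B) : pullbackMapW f x = zeroW ↔ x = zeroW := by
  rw [← pullbackMapW_zeroW f, (pullbackMapW_bijective_of_bijective f hf).1.eq_iff]

end Ext

namespace Extension

variable {VE' : Type*} [AddCommGroup VE'] [Module ℚ VE'] {E : Extension A B VE} {E' : Extension A' B' VE'}

omit [FiniteDimensional ℚ VA] [FiniteDimensional ℚ VB] [FiniteDimensional ℚ VE] in
/-- **A morphism of extensions `(β, φ, α) : E → E'` with `β`, `α` isomorphisms identifies the classes up
to transport** (`β_* [E] = α^* [E']`, Prop. 1.8): in particular `E` splits iff `E'` splits.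
[cite: MacLane1963Homology, Ch. III Prop. 1.8] -/
theorem Morphism.isSplit_iff_of_bijective (m : Morphism E E') (hl : Function.Bijective m.left.toLinearMap)
    (hr : Function.Bijective m.right.toLinearMap) : E.IsSplit ↔ E'.IsSplit := by
  rw [← Ext.mkOfW_eq_zeroW_iff, ← Ext.mkOfW_eq_zeroW_iff,
    ← Ext.pushoutMapW_eq_zeroW_iff_of_bijective m.left hl, Ext.pushoutMapW_mkOfW_eq_pullbackMapW_mkOfW m,
    Ext.pullbackMapW_eq_zeroW_iff_of_bijective m.right hr]

end Extension

end Transport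

/-! ### §1 The direct sum of classes `prodW : Ext(A₁, B₁) × Ext(A₂, B₂) → Ext(A₁ ⊕ A₂, B₁ ⊕ B₂)` -/

section ProdW

variable {V₁ V₂ W₁ W₂ : Type*} [AddCommGroup V₁] [Module ℚ V₁] [AddCommGroup V₂] [Module ℚ V₂]
  [AddCommGroup W₁] [Module ℚ W₁] [AddCommGroup W₂] [Module ℚ W₂]
variable {A₁ : MixedHodgeStructure V₁} {A₂ : MixedHodgeStructure V₂}
variable {B₁ : MixedHodgeStructure W₁} {B₂ : MixedHodgeStructure W₂}

namespace Ext

/-- **The direct sum of two extension classes**: `prodW x₁ x₂ := (ι₁)_* π₁^* x₁ + (ι₂)_* π₂^* x₂` in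
`Ext(A₁ ⊕ A₂, B₁ ⊕ B₂)`; it is the class of `E₁ ⊕ E₂` (`prodW_mkOfW`, Mac Lane III (2.3)).
[cite: MacLane1963Homology, Ch. III (2.3)] -/
def prodW (x₁ : Ext A₁ B₁) (x₂ : Ext A₂ B₂) : Ext (A₁.prod A₂) (B₁.prod B₂) :=
  addW (pushoutMapW (Hom.inl B₁ B₂) (pullbackMapW (Hom.fst A₁ A₂) x₁))
    (pushoutMapW (Hom.inr B₁ B₂) (pullbackMapW (Hom.snd A₁ A₂) x₂))

/-- `prodW` unfolded. [cite: MacLane1963Homology, Ch. III (2.3)] -/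
theorem prodW_def (x₁ : Ext A₁ B₁) (x₂ : Ext A₂ B₂) :
    prodW x₁ x₂ = addW (pushoutMapW (Hom.inl B₁ B₂) (pullbackMapW (Hom.fst A₁ A₂) x₁))
      (pushoutMapW (Hom.inr B₁ B₂) (pullbackMapW (Hom.snd A₁ A₂) x₂)) := rfl

/-- **`prodW [E₁] [E₂] = [E₁ ⊕ E₂]`.** [cite: MacLane1963Homology, Ch. III (2.3)] -/
theorem prodW_mkOfW {VE₁ VE₂ : Type*} [AddCommGroup VE₁] [Module ℚ VE₁] [AddCommGroup VE₂] [Module ℚ VE₂]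
    (E₁ : Extension A₁ B₁ VE₁) (E₂ : Extension A₂ B₂ VE₂) :
    prodW (mkOfW E₁) (mkOfW E₂) = mkOfW (E₁.prod E₂) :=
  (mkOfW_prod E₁ E₂).symm

/-- The `(1,1)` coordinate of `prodW x₁ x₂` is `x₁`: `π₁_* ι₁^* prodW x₁ x₂ = x₁`. [cite: MacLane1963Homology, Ch. III Thm. 2.1] -/
theorem pushoutMapW_fst_pullbackMapW_inl_prodW (x₁ : Ext A₁ B₁) (x₂ : Ext A₂ B₂) :
    pushoutMapW (Hom.fst B₁ B₂) (pullbackMapW (Hom.inl A₁ A₂) (prodW x₁ x₂)) = x₁ := by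
  rw [prodW, pullbackMapW_addW, pushoutMapW_addW, ← pushoutMapW_pullbackMapW, ← pushoutMapW_pullbackMapW,
    pushoutMapW_fst_pushoutMapW_inl, pushoutMapW_fst_pushoutMapW_inr, pullbackMapW_inl_pullbackMapW_fst,
    addW_comm, zeroW_addW]

/-- The `(2,2)` coordinate of `prodW x₁ x₂` is `x₂`: `π₂_* ι₂^* prodW x₁ x₂ = x₂`. [cite: MacLane1963Homology, Ch. III Thm. 2.1] -/
theorem pushoutMapW_snd_pullbackMapW_inr_prodW (x₁ : Ext A₁ B₁) (x₂ : Ext A₂ B₂) :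
    pushoutMapW (Hom.snd B₁ B₂) (pullbackMapW (Hom.inr A₁ A₂) (prodW x₁ x₂)) = x₂ := by
  rw [prodW, pullbackMapW_addW, pushoutMapW_addW, ← pushoutMapW_pullbackMapW, ← pushoutMapW_pullbackMapW,
    pushoutMapW_snd_pushoutMapW_inl, pushoutMapW_snd_pushoutMapW_inr, pullbackMapW_inr_pullbackMapW_snd,
    zeroW_addW]

/-- The `(2,1)` coordinate of `prodW x₁ x₂` vanishes. [cite: MacLane1963Homology, Ch. III Thm. 2.1] -/
theorem pushoutMapW_snd_pullbackMapW_inl_prodW (x₁ : Ext A₁ B₁) (x₂ : Ext A₂ B₂) :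
    pushoutMapW (Hom.snd B₁ B₂) (pullbackMapW (Hom.inl A₁ A₂) (prodW x₁ x₂)) = zeroW := by
  rw [prodW, pullbackMapW_addW, pushoutMapW_addW, ← pushoutMapW_pullbackMapW, ← pushoutMapW_pullbackMapW,
    pushoutMapW_snd_pushoutMapW_inl, pushoutMapW_snd_pushoutMapW_inr, pullbackMapW_inl_pullbackMapW_snd,
    zeroW_addW]

/-- The `(1,2)` coordinate of `prodW x₁ x₂` vanishes. [cite: MacLane1963Homology, Ch. III Thm. 2.1] -/
theorem pushoutMapW_fst_pullbackMapW_inr_prodW (x₁ : Ext A₁ B₁) (x₂ : Ext A₂ B₂) :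
    pushoutMapW (Hom.fst B₁ B₂) (pullbackMapW (Hom.inr A₁ A₂) (prodW x₁ x₂)) = zeroW := by
  rw [prodW, pullbackMapW_addW, pushoutMapW_addW, ← pushoutMapW_pullbackMapW, ← pushoutMapW_pullbackMapW,
    pushoutMapW_fst_pushoutMapW_inl, pushoutMapW_fst_pushoutMapW_inr, pullbackMapW_inr_pullbackMapW_fst,
    zeroW_addW]

/-- **`prodW` is injective**: the summands are recovered as the diagonal coordinates.
[cite: MacLane1963Homology, Ch. III Thm. 2.1] -/
theorem prodW_injective2 (x₁ y₁ : Ext A₁ B₁) (x₂ y₂ : Ext A₂ B₂) (h : prodW x₁ x₂ = prodW y₁ y₂) :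
    x₁ = y₁ ∧ x₂ = y₂ :=
  ⟨by rw [← pushoutMapW_fst_pullbackMapW_inl_prodW x₁ x₂, h, pushoutMapW_fst_pullbackMapW_inl_prodW],
    by rw [← pushoutMapW_snd_pullbackMapW_inr_prodW x₁ x₂, h, pushoutMapW_snd_pullbackMapW_inr_prodW]⟩

/-- **`prodW` is additive**: `(x₁ + y₁) ⊕ (x₂ + y₂) = (x₁ ⊕ x₂) + (y₁ ⊕ y₂)`. [cite: MacLane1963Homology, Ch. III Thm. 2.1] -/
theorem prodW_addW (x₁ y₁ : Ext A₁ B₁) (x₂ y₂ : Ext A₂ B₂) :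
    prodW (addW x₁ y₁) (addW x₂ y₂) = addW (prodW x₁ x₂) (prodW y₁ y₂) := by
  apply extEquivJHomW.injective
  simp only [prodW, pullbackMapW_addW, pushoutMapW_addW, extEquivJHomW_addW]
  abel

/-- `0 ⊕ 0 = 0`. [cite: MacLane1963Homology, Ch. III Thm. 2.1] -/
theorem prodW_zeroW : prodW (zeroW : Ext A₁ B₁) (zeroW : Ext A₂ B₂) = zeroW := by
  rw [prodW, pullbackMapW_zeroW, pullbackMapW_zeroW, pushoutMapW_zeroW, pushoutMapW_zeroW, zeroW_addW]

/-- `(-x₁) ⊕ (-x₂) = -(x₁ ⊕ x₂)`. [cite: MacLane1963Homology, Ch. III Thm. 2.1] -/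
theorem prodW_negW (x₁ : Ext A₁ B₁) (x₂ : Ext A₂ B₂) :
    prodW (negW x₁) (negW x₂) = negW (prodW x₁ x₂) := by
  apply extEquivJHomW.injective
  simp only [prodW, pullbackMapW_negW, pushoutMapW_negW, extEquivJHomW_addW, extEquivJHomW_negW]
  abel

/-- `prodW x₁ x₂ = 0 ↔ x₁ = 0 ∧ x₂ = 0`. [cite: MacLane1963Homology, Ch. III Thm. 2.1] -/
theorem prodW_eq_zeroW_iff (x₁ : Ext A₁ B₁) (x₂ : Ext A₂ B₂) :
    prodW x₁ x₂ = zeroW ↔ x₁ = zeroW ∧ x₂ = zeroW := by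
  constructor
  · intro h
    exact prodW_injective2 _ _ _ _ (h.trans prodW_zeroW.symm)
  · rintro ⟨rfl, rfl⟩
    exact prodW_zeroW

/-- `prodW x₁ 0 = (ι₁)_* π₁^* x₁`. [cite: MacLane1963Homology, Ch. III (2.3)] -/
theorem prodW_zeroW_right (x₁ : Ext A₁ B₁) :
    prodW x₁ (zeroW : Ext A₂ B₂) = pushoutMapW (Hom.inl B₁ B₂) (pullbackMapW (Hom.fst A₁ A₂) x₁) := by
  rw [prodW, pullbackMapW_zeroW, pushoutMapW_zeroW, addW_comm, zeroW_addW]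

/-- `prodW 0 x₂ = (ι₂)_* π₂^* x₂`. [cite: MacLane1963Homology, Ch. III (2.3)] -/
theorem prodW_zeroW_left (x₂ : Ext A₂ B₂) :
    prodW (zeroW : Ext A₁ B₁) x₂ = pushoutMapW (Hom.inr B₁ B₂) (pullbackMapW (Hom.snd A₁ A₂) x₂) := by
  rw [prodW, pullbackMapW_zeroW, pushoutMapW_zeroW, zeroW_addW]

variable {V₁' V₂' W₁' W₂' : Type*} [AddCommGroup V₁'] [Module ℚ V₁'] [AddCommGroup V₂'] [Module ℚ V₂']
  [AddCommGroup W₁'] [Module ℚ W₁'] [AddCommGroup W₂'] [Module ℚ W₂']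
variable {A₁' : MixedHodgeStructure V₁'} {A₂' : MixedHodgeStructure V₂'}
variable {B₁' : MixedHodgeStructure W₁'} {B₂' : MixedHodgeStructure W₂'}

/-- **Naturality of `prodW` in the subs**: `(g₁ ⊕ g₂)_* (x₁ ⊕ x₂) = (g₁_* x₁) ⊕ (g₂_* x₂)`.
[cite: MacLane1963Homology, Ch. III (2.3)] -/
theorem pushoutMapW_prodMap_prodW (g₁ : Hom B₁ B₁') (g₂ : Hom B₂ B₂') (x₁ : Ext A₁ B₁) (x₂ : Ext A₂ B₂) :
    pushoutMapW (Hom.prodMap g₁ g₂) (prodW x₁ x₂) = prodW (pushoutMapW g₁ x₁) (pushoutMapW g₂ x₂) := by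
  rw [prodW, prodW, pushoutMapW_addW, ← pushoutMapW_comp, ← pushoutMapW_comp, Hom.prodMap_comp_inl,
    Hom.prodMap_comp_inr, pushoutMapW_comp, pushoutMapW_comp]
  simp only [← pushoutMapW_pullbackMapW]

/-- **Naturality of `prodW` in the quotients**: `(f₁ ⊕ f₂)^* (x₁ ⊕ x₂) = (f₁^* x₁) ⊕ (f₂^* x₂)`.
[cite: MacLane1963Homology, Ch. III (2.3)] -/
theorem pullbackMapW_prodMap_prodW (f₁ : Hom A₁' A₁) (f₂ : Hom A₂' A₂) (x₁ : Ext A₁ B₁) (x₂ : Ext A₂ B₂) :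
    pullbackMapW (Hom.prodMap f₁ f₂) (prodW x₁ x₂) = prodW (pullbackMapW f₁ x₁) (pullbackMapW f₂ x₂) := by
  rw [prodW, prodW, pullbackMapW_addW]
  simp only [← pushoutMapW_pullbackMapW]
  rw [← pullbackMapW_comp, ← pullbackMapW_comp, Hom.fst_comp_prodMap, Hom.snd_comp_prodMap,
    pullbackMapW_comp, pullbackMapW_comp]

/-- Under `prodEquivLeft`/`prodEquivRight`: the coordinates of `prodW x₁ x₂` are `((x₁, 0), (0, x₂))`.
[cite: MacLane1963Homology, Ch. III Thm. 2.1] -/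
theorem prodEquivRight_prodEquivLeft_prodW (x₁ : Ext A₁ B₁) (x₂ : Ext A₂ B₂) :
    (prodEquivRight A₁ B₁ B₂ (prodEquivLeft A₁ A₂ (B₁.prod B₂) (prodW x₁ x₂)).1,
      prodEquivRight A₂ B₁ B₂ (prodEquivLeft A₁ A₂ (B₁.prod B₂) (prodW x₁ x₂)).2) =
      ((x₁, zeroW), (zeroW, x₂)) := by
  rw [prodEquivLeft_apply, prodEquivRight_apply, prodEquivRight_apply,
    pushoutMapW_fst_pullbackMapW_inl_prodW, pushoutMapW_snd_pullbackMapW_inl_prodW,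
    pushoutMapW_fst_pullbackMapW_inr_prodW, pushoutMapW_snd_pullbackMapW_inr_prodW]

end Ext

end ProdW

/-! ### §2 `Hom(C₁ ⊕ C₂, E) ≅ Hom(C₁, E) ⊕ Hom(C₂, E)` as extensions -/

section HomLeftProd

variable {A : MixedHodgeStructure VA} {B : MixedHodgeStructure VB} (E : Extension A B VE)
  (C₁ : MixedHodgeStructure VC₁) (C₂ : MixedHodgeStructure VC₂)

namespace Extension

/-- **The morphism of extensions `Hom(C₁ ⊕ C₂, E) → Hom(C₁, E) ⊕ Hom(C₂, E)`**, `φ ↦ (φ ∘ ι₁, φ ∘ ι₂)`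
termwise, over `(homProdLeftTo C₁ C₂ B, homProdLeftTo C₁ C₂ E, homProdLeftTo C₁ C₂ A)` — all three
components are isomorphisms of MHS (Mac Lane I (6.5) for the additive functor `Hom(−, E)` of MHS).
[cite: MacLane1963Homology, Ch. I (6.5)] [cite: DeligneHodgeII1971, 1.1.12] -/
def homLeftProdMorphism : Morphism (E.homLeft (C₁.prod C₂)) ((E.homLeft C₁).prod (E.homLeft C₂)) where
  left := homProdLeftTo C₁ C₂ B
  mid := homProdLeftTo C₁ C₂ E.mhs
  right := homProdLeftTo C₁ C₂ A
  mid_inc := by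
    change (homProdLeftTo C₁ C₂ E.mhs).toLinearMap ∘ₗ (Hom.homMap (Hom.id (C₁.prod C₂)) E.inc).toLinearMap =
      (Hom.prodMap (Hom.homMap (Hom.id C₁) E.inc) (Hom.homMap (Hom.id C₂) E.inc)).toLinearMap ∘ₗ
        (homProdLeftTo C₁ C₂ B).toLinearMap
    exact congrArg Hom.toLinearMap (homProdLeftTo_comp_homMap_id (A₁ := C₁) (A₂ := C₂) E.inc)
  proj_mid := by
    change (Hom.prodMap (Hom.homMap (Hom.id C₁) E.proj) (Hom.homMap (Hom.id C₂) E.proj)).toLinearMap ∘ₗ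
        (homProdLeftTo C₁ C₂ E.mhs).toLinearMap =
      (homProdLeftTo C₁ C₂ A).toLinearMap ∘ₗ (Hom.homMap (Hom.id (C₁.prod C₂)) E.proj).toLinearMap
    exact congrArg Hom.toLinearMap (homProdLeftTo_comp_homMap_id (A₁ := C₁) (A₂ := C₂) E.proj).symm

/-- Components of `homLeftProdMorphism` (by `rfl`). [cite: MacLane1963Homology, Ch. I (6.5)] -/
@[simp]
theorem homLeftProdMorphism_left : (E.homLeftProdMorphism C₁ C₂).left = homProdLeftTo C₁ C₂ B := rfl

/-- Components of `homLeftProdMorphism` (by `rfl`). [cite: MacLane1963Homology, Ch. I (6.5)] -/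
@[simp]
theorem homLeftProdMorphism_mid : (E.homLeftProdMorphism C₁ C₂).mid = homProdLeftTo C₁ C₂ E.mhs := rfl

/-- Components of `homLeftProdMorphism` (by `rfl`). [cite: MacLane1963Homology, Ch. I (6.5)] -/
@[simp]
theorem homLeftProdMorphism_right : (E.homLeftProdMorphism C₁ C₂).right = homProdLeftTo C₁ C₂ A := rfl

/-- **`(≅)_* [Hom(C₁ ⊕ C₂, E)]_W = (≅)^* [Hom(C₁, E) ⊕ Hom(C₂, E)]_W`** (Prop. 1.8 along
`homLeftProdMorphism`). [cite: MacLane1963Homology, Ch. III Prop. 1.8] -/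
theorem postcomp_clsW_homLeft_prod :
    JHomW.postcomp (hom (C₁.prod C₂) A) (homProdLeftTo C₁ C₂ B) (E.homLeft (C₁.prod C₂)).clsW =
      JHomW.precomp ((hom C₁ B).prod (hom C₂ B)) (homProdLeftTo C₁ C₂ A)
        ((E.homLeft C₁).prod (E.homLeft C₂)).clsW :=
  (E.homLeftProdMorphism C₁ C₂).postcomp_clsW_eq_precomp_clsW

/-- **`(≅)_* Hom(C₁ ⊕ C₂, E) ≡ (≅)^* (Hom(C₁, E) ⊕ Hom(C₂, E))`** as extensions. [cite: MacLane1963Homology, Ch. III Prop. 1.8] -/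
theorem nonempty_congruence_homLeft_prod :
    Nonempty (Congruence ((E.homLeft (C₁.prod C₂)).pushout (homProdLeftTo C₁ C₂ B))
      (((E.homLeft C₁).prod (E.homLeft C₂)).pullback (homProdLeftTo C₁ C₂ A))) :=
  nonempty_congruence_pushout_pullback_of_morphism (E.homLeftProdMorphism C₁ C₂)

/-- **`Hom(C₁ ⊕ C₂, E)` splits iff `Hom(C₁, E)` and `Hom(C₂, E)` both split.**
[cite: MacLane1963Homology, Ch. III Prop. 1.8] -/
theorem isSplit_homLeft_prod_iff :
    (E.homLeft (C₁.prod C₂)).IsSplit ↔ (E.homLeft C₁).IsSplit ∧ (E.homLeft C₂).IsSplit := by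
  rw [(E.homLeftProdMorphism C₁ C₂).isSplit_iff_of_bijective (homProdLeftTo_bijective C₁ C₂ B)
    (homProdLeftTo_bijective C₁ C₂ A), isSplit_prod_iff]

end Extension

namespace Ext

/-- **`(≅)_* Hom(C₁ ⊕ C₂, x) = (≅)^* (Hom(C₁, x) ⊕ Hom(C₂, x))`** in `Ext(Hom(C₁ ⊕ C₂, A), Hom(C₁, B) ⊕ Hom(C₂, B))`,
for every class `x ∈ Ext(A, B)`: the functor `Hom(−, x)` on extensions is additive in the MHS argument.
[cite: MacLane1963Homology, Ch. III Prop. 1.8] [cite: DeligneHodgeII1971, 1.1.12] -/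
theorem pushoutMapW_homLeftMap_prod (x : Ext A B) :
    pushoutMapW (homProdLeftTo C₁ C₂ B) (homLeftMap (C₁.prod C₂) x) =
      pullbackMapW (homProdLeftTo C₁ C₂ A) (prodW (homLeftMap C₁ x) (homLeftMap C₂ x)) := by
  obtain ⟨E, rfl⟩ := exists_mkOfW_eq x
  rw [homLeftMap_mkOfW, homLeftMap_mkOfW, homLeftMap_mkOfW, prodW_mkOfW]
  exact pushoutMapW_mkOfW_eq_pullbackMapW_mkOfW (E.homLeftProdMorphism C₁ C₂)

/-- **Transport form**: `(≅)_* (≅⁻¹)^* Hom(C₁ ⊕ C₂, x) = Hom(C₁, x) ⊕ Hom(C₂, x)` — under the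
identification `Ext(Hom(C₁ ⊕ C₂, A), Hom(C₁ ⊕ C₂, B)) ≃ Ext(Hom(C₁,A) ⊕ Hom(C₂,A), Hom(C₁,B) ⊕ Hom(C₂,B))`
by transport of structure, `Hom(C₁ ⊕ C₂, x)` IS the direct sum of the classes `Hom(Cᵢ, x)`.
[cite: MacLane1963Homology, Ch. III Prop. 1.8] [cite: DeligneHodgeII1971, 1.1.12] -/
theorem transport_homLeftMap_prod (x : Ext A B) :
    pushoutMapW (homProdLeftTo C₁ C₂ B)
        (pullbackMapW (homProdLeftInv C₁ C₂ A) (homLeftMap (C₁.prod C₂) x)) =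
      prodW (homLeftMap C₁ x) (homLeftMap C₂ x) := by
  rw [pushoutMapW_pullbackMapW, pushoutMapW_homLeftMap_prod, ← pullbackMapW_comp,
    homProdLeftTo_comp_homProdLeftInv, pullbackMapW_id]

/-- **Solved for `Hom(C₁ ⊕ C₂, x)`**: `Hom(C₁ ⊕ C₂, x) = (≅⁻¹)_* (≅)^* (Hom(C₁, x) ⊕ Hom(C₂, x))`.
[cite: MacLane1963Homology, Ch. III Prop. 1.8] [cite: DeligneHodgeII1971, 1.1.12] -/
theorem homLeftMap_prod_eq (x : Ext A B) :
    homLeftMap (C₁.prod C₂) x =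
      pushoutMapW (homProdLeftInv C₁ C₂ B)
        (pullbackMapW (homProdLeftTo C₁ C₂ A) (prodW (homLeftMap C₁ x) (homLeftMap C₂ x))) := by
  rw [← pushoutMapW_homLeftMap_prod, ← pushoutMapW_comp, homProdLeftInv_comp_homProdLeftTo, pushoutMapW_id]

/-- `Hom(C₁ ⊕ C₂, x) = 0 ↔ Hom(C₁, x) = 0 ∧ Hom(C₂, x) = 0`. [cite: MacLane1963Homology, Ch. III Prop. 1.8] -/
theorem homLeftMap_prod_eq_zeroW_iff (x : Ext A B) :
    homLeftMap (C₁.prod C₂) x = zeroW ↔ homLeftMap C₁ x = zeroW ∧ homLeftMap C₂ x = zeroW := by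
  rw [← prodW_eq_zeroW_iff, ← transport_homLeftMap_prod,
    pushoutMapW_eq_zeroW_iff_of_bijective _ (homProdLeftTo_bijective C₁ C₂ B),
    pullbackMapW_eq_zeroW_iff_of_bijective _ (homProdLeftInv_bijective C₁ C₂ A)]

end Ext

end HomLeftProd

/-! ### §3 `Hom(E, C₁ ⊕ C₂) ≅ Hom(E, C₁) ⊕ Hom(E, C₂)` as extensions -/

section HomRightProd

variable {A : MixedHodgeStructure VA} {B : MixedHodgeStructure VB} (E : Extension A B VE)
  (C₁ : MixedHodgeStructure VC₁) (C₂ : MixedHodgeStructure VC₂)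

namespace Extension

/-- **The morphism of extensions `Hom(E, C₁ ⊕ C₂) → Hom(E, C₁) ⊕ Hom(E, C₂)`**, `φ ↦ (π₁ ∘ φ, π₂ ∘ φ)`
termwise, over `(homProdRightTo A C₁ C₂, homProdRightTo E C₁ C₂, homProdRightTo B C₁ C₂)` (recall
`Hom(E, C) : 0 → Hom(A, C) → Hom(E, C) → Hom(B, C) → 0`; Mac Lane I (6.5) for `Hom(E, −)`).
[cite: MacLane1963Homology, Ch. I (6.5)] [cite: DeligneHodgeII1971, 1.1.12] -/
def homRightProdMorphism : Morphism (E.homRight (C₁.prod C₂)) ((E.homRight C₁).prod (E.homRight C₂)) where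
  left := homProdRightTo A C₁ C₂
  mid := homProdRightTo E.mhs C₁ C₂
  right := homProdRightTo B C₁ C₂
  mid_inc := by
    change (homProdRightTo E.mhs C₁ C₂).toLinearMap ∘ₗ (Hom.homMap E.proj (Hom.id (C₁.prod C₂))).toLinearMap =
      (Hom.prodMap (Hom.homMap E.proj (Hom.id C₁)) (Hom.homMap E.proj (Hom.id C₂))).toLinearMap ∘ₗ
        (homProdRightTo A C₁ C₂).toLinearMap
    exact congrArg Hom.toLinearMap (homProdRightTo_comp_homMap_id (B₁ := C₁) (B₂ := C₂) E.proj)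
  proj_mid := by
    change (Hom.prodMap (Hom.homMap E.inc (Hom.id C₁)) (Hom.homMap E.inc (Hom.id C₂))).toLinearMap ∘ₗ
        (homProdRightTo E.mhs C₁ C₂).toLinearMap =
      (homProdRightTo B C₁ C₂).toLinearMap ∘ₗ (Hom.homMap E.inc (Hom.id (C₁.prod C₂))).toLinearMap
    exact congrArg Hom.toLinearMap (homProdRightTo_comp_homMap_id (B₁ := C₁) (B₂ := C₂) E.inc).symm

/-- Components of `homRightProdMorphism` (by `rfl`). [cite: MacLane1963Homology, Ch. I (6.5)] -/
@[simp]
theorem homRightProdMorphism_left : (E.homRightProdMorphism C₁ C₂).left = homProdRightTo A C₁ C₂ := rfl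

/-- Components of `homRightProdMorphism` (by `rfl`). [cite: MacLane1963Homology, Ch. I (6.5)] -/
@[simp]
theorem homRightProdMorphism_mid : (E.homRightProdMorphism C₁ C₂).mid = homProdRightTo E.mhs C₁ C₂ := rfl

/-- Components of `homRightProdMorphism` (by `rfl`). [cite: MacLane1963Homology, Ch. I (6.5)] -/
@[simp]
theorem homRightProdMorphism_right : (E.homRightProdMorphism C₁ C₂).right = homProdRightTo B C₁ C₂ := rfl

/-- **`(≅)_* [Hom(E, C₁ ⊕ C₂)]_W = (≅)^* [Hom(E, C₁) ⊕ Hom(E, C₂)]_W`.** [cite: MacLane1963Homology, Ch. III Prop. 1.8] -/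
theorem postcomp_clsW_homRight_prod :
    JHomW.postcomp (hom B (C₁.prod C₂)) (homProdRightTo A C₁ C₂) (E.homRight (C₁.prod C₂)).clsW =
      JHomW.precomp ((hom A C₁).prod (hom A C₂)) (homProdRightTo B C₁ C₂)
        ((E.homRight C₁).prod (E.homRight C₂)).clsW :=
  (E.homRightProdMorphism C₁ C₂).postcomp_clsW_eq_precomp_clsW

/-- **`(≅)_* Hom(E, C₁ ⊕ C₂) ≡ (≅)^* (Hom(E, C₁) ⊕ Hom(E, C₂))`** as extensions. [cite: MacLane1963Homology, Ch. III Prop. 1.8] -/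
theorem nonempty_congruence_homRight_prod :
    Nonempty (Congruence ((E.homRight (C₁.prod C₂)).pushout (homProdRightTo A C₁ C₂))
      (((E.homRight C₁).prod (E.homRight C₂)).pullback (homProdRightTo B C₁ C₂))) :=
  nonempty_congruence_pushout_pullback_of_morphism (E.homRightProdMorphism C₁ C₂)

/-- **`Hom(E, C₁ ⊕ C₂)` splits iff `Hom(E, C₁)` and `Hom(E, C₂)` both split.** [cite: MacLane1963Homology, Ch. III Prop. 1.8] -/
theorem isSplit_homRight_prod_iff :
    (E.homRight (C₁.prod C₂)).IsSplit ↔ (E.homRight C₁).IsSplit ∧ (E.homRight C₂).IsSplit := by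
  rw [(E.homRightProdMorphism C₁ C₂).isSplit_iff_of_bijective (homProdRightTo_bijective A C₁ C₂)
    (homProdRightTo_bijective B C₁ C₂), isSplit_prod_iff]

end Extension

namespace Ext

/-- **`(≅)_* Hom(x, C₁ ⊕ C₂) = (≅)^* (Hom(x, C₁) ⊕ Hom(x, C₂))`** for every class `x ∈ Ext(A, B)`.
[cite: MacLane1963Homology, Ch. III Prop. 1.8] [cite: DeligneHodgeII1971, 1.1.12] -/
theorem pushoutMapW_homRightMap_prod (x : Ext A B) :
    pushoutMapW (homProdRightTo A C₁ C₂) (homRightMap (C₁.prod C₂) x) =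
      pullbackMapW (homProdRightTo B C₁ C₂) (prodW (homRightMap C₁ x) (homRightMap C₂ x)) := by
  obtain ⟨E, rfl⟩ := exists_mkOfW_eq x
  rw [homRightMap_mkOfW, homRightMap_mkOfW, homRightMap_mkOfW, prodW_mkOfW]
  exact pushoutMapW_mkOfW_eq_pullbackMapW_mkOfW (E.homRightProdMorphism C₁ C₂)

/-- **Transport form**: `(≅)_* (≅⁻¹)^* Hom(x, C₁ ⊕ C₂) = Hom(x, C₁) ⊕ Hom(x, C₂)`.
[cite: MacLane1963Homology, Ch. III Prop. 1.8] [cite: DeligneHodgeII1971, 1.1.12] -/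
theorem transport_homRightMap_prod (x : Ext A B) :
    pushoutMapW (homProdRightTo A C₁ C₂)
        (pullbackMapW (homProdRightInv B C₁ C₂) (homRightMap (C₁.prod C₂) x)) =
      prodW (homRightMap C₁ x) (homRightMap C₂ x) := by
  rw [pushoutMapW_pullbackMapW, pushoutMapW_homRightMap_prod, ← pullbackMapW_comp,
    homProdRightTo_comp_homProdRightInv, pullbackMapW_id]

/-- **Solved for `Hom(x, C₁ ⊕ C₂)`**: `Hom(x, C₁ ⊕ C₂) = (≅⁻¹)_* (≅)^* (Hom(x, C₁) ⊕ Hom(x, C₂))`.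
[cite: MacLane1963Homology, Ch. III Prop. 1.8] [cite: DeligneHodgeII1971, 1.1.12] -/
theorem homRightMap_prod_eq (x : Ext A B) :
    homRightMap (C₁.prod C₂) x =
      pushoutMapW (homProdRightInv A C₁ C₂)
        (pullbackMapW (homProdRightTo B C₁ C₂) (prodW (homRightMap C₁ x) (homRightMap C₂ x))) := by
  rw [← pushoutMapW_homRightMap_prod, ← pushoutMapW_comp, homProdRightInv_comp_homProdRightTo, pushoutMapW_id]

/-- `Hom(x, C₁ ⊕ C₂) = 0 ↔ Hom(x, C₁) = 0 ∧ Hom(x, C₂) = 0`. [cite: MacLane1963Homology, Ch. III Prop. 1.8] -/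
theorem homRightMap_prod_eq_zeroW_iff (x : Ext A B) :
    homRightMap (C₁.prod C₂) x = zeroW ↔ homRightMap C₁ x = zeroW ∧ homRightMap C₂ x = zeroW := by
  rw [← prodW_eq_zeroW_iff, ← transport_homRightMap_prod,
    pushoutMapW_eq_zeroW_iff_of_bijective _ (homProdRightTo_bijective A C₁ C₂),
    pullbackMapW_eq_zeroW_iff_of_bijective _ (homProdRightInv_bijective B C₁ C₂)]

end Ext

end HomRightProd

/-! ### §4 `E ⊗ (C₁ ⊕ C₂) ≅ (E ⊗ C₁) ⊕ (E ⊗ C₂)` and `(C₁ ⊕ C₂) ⊗ E ≅ (C₁ ⊗ E) ⊕ (C₂ ⊗ E)` as extensions -/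

section TensorProd

variable {A : MixedHodgeStructure VA} {B : MixedHodgeStructure VB} (E : Extension A B VE)
  (C₁ : MixedHodgeStructure VC₁) (C₂ : MixedHodgeStructure VC₂)

namespace Extension

/-- **The morphism of extensions `E ⊗ (C₁ ⊕ C₂) → (E ⊗ C₁) ⊕ (E ⊗ C₂)`** (Mac Lane's `ζ` termwise), over
`(tensorProdRightTo B C₁ C₂, tensorProdRightTo E C₁ C₂, tensorProdRightTo A C₁ C₂)`.
[cite: MacLane1963Homology, Ch. V (1.6)] [cite: DeligneHodgeII1971, 1.1.12] -/
def rTensorProdMorphism : Morphism (E.rTensor (C₁.prod C₂)) ((E.rTensor C₁).prod (E.rTensor C₂)) where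
  left := tensorProdRightTo B C₁ C₂
  mid := tensorProdRightTo E.mhs C₁ C₂
  right := tensorProdRightTo A C₁ C₂
  mid_inc := by
    change (tensorProdRightTo E.mhs C₁ C₂).toLinearMap ∘ₗ (E.inc.tensorMap (Hom.id (C₁.prod C₂))).toLinearMap =
      (Hom.prodMap (E.inc.tensorMap (Hom.id C₁)) (E.inc.tensorMap (Hom.id C₂))).toLinearMap ∘ₗ
        (tensorProdRightTo B C₁ C₂).toLinearMap
    rw [← Hom.prodMap_id]
    exact congrArg Hom.toLinearMap (tensorProdRightTo_comp_tensorMap_prodMap E.inc (Hom.id C₁) (Hom.id C₂))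
  proj_mid := by
    change (Hom.prodMap (E.proj.tensorMap (Hom.id C₁)) (E.proj.tensorMap (Hom.id C₂))).toLinearMap ∘ₗ
        (tensorProdRightTo E.mhs C₁ C₂).toLinearMap =
      (tensorProdRightTo A C₁ C₂).toLinearMap ∘ₗ (E.proj.tensorMap (Hom.id (C₁.prod C₂))).toLinearMap
    rw [← Hom.prodMap_id]
    exact congrArg Hom.toLinearMap (tensorProdRightTo_comp_tensorMap_prodMap E.proj (Hom.id C₁) (Hom.id C₂)).symm

/-- Components of `rTensorProdMorphism` (by `rfl`). [cite: MacLane1963Homology, Ch. V (1.6)] -/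
@[simp]
theorem rTensorProdMorphism_left : (E.rTensorProdMorphism C₁ C₂).left = tensorProdRightTo B C₁ C₂ := rfl

/-- Components of `rTensorProdMorphism` (by `rfl`). [cite: MacLane1963Homology, Ch. V (1.6)] -/
@[simp]
theorem rTensorProdMorphism_right : (E.rTensorProdMorphism C₁ C₂).right = tensorProdRightTo A C₁ C₂ := rfl

/-- **`ζ_* [E ⊗ (C₁ ⊕ C₂)]_W = ζ^* [(E ⊗ C₁) ⊕ (E ⊗ C₂)]_W`.** [cite: MacLane1963Homology, Ch. III Prop. 1.8] -/
theorem postcomp_clsW_rTensor_prod :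
    JHomW.postcomp (tensor A (C₁.prod C₂)) (tensorProdRightTo B C₁ C₂) (E.rTensor (C₁.prod C₂)).clsW =
      JHomW.precomp ((tensor B C₁).prod (tensor B C₂)) (tensorProdRightTo A C₁ C₂)
        ((E.rTensor C₁).prod (E.rTensor C₂)).clsW :=
  (E.rTensorProdMorphism C₁ C₂).postcomp_clsW_eq_precomp_clsW

/-- **`ζ_* (E ⊗ (C₁ ⊕ C₂)) ≡ ζ^* ((E ⊗ C₁) ⊕ (E ⊗ C₂))`** as extensions. [cite: MacLane1963Homology, Ch. III Prop. 1.8] -/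
theorem nonempty_congruence_rTensor_prod :
    Nonempty (Congruence ((E.rTensor (C₁.prod C₂)).pushout (tensorProdRightTo B C₁ C₂))
      (((E.rTensor C₁).prod (E.rTensor C₂)).pullback (tensorProdRightTo A C₁ C₂))) :=
  nonempty_congruence_pushout_pullback_of_morphism (E.rTensorProdMorphism C₁ C₂)

/-- **`E ⊗ (C₁ ⊕ C₂)` splits iff `E ⊗ C₁` and `E ⊗ C₂` both split.** [cite: MacLane1963Homology, Ch. III Prop. 1.8] -/
theorem isSplit_rTensor_prod_iff :
    (E.rTensor (C₁.prod C₂)).IsSplit ↔ (E.rTensor C₁).IsSplit ∧ (E.rTensor C₂).IsSplit := by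
  rw [(E.rTensorProdMorphism C₁ C₂).isSplit_iff_of_bijective (tensorProdRightTo_bijective B C₁ C₂)
    (tensorProdRightTo_bijective A C₁ C₂), isSplit_prod_iff]

/-- **The morphism of extensions `(C₁ ⊕ C₂) ⊗ E → (C₁ ⊗ E) ⊕ (C₂ ⊗ E)`**, over
`(tensorProdLeftTo C₁ C₂ B, tensorProdLeftTo C₁ C₂ E, tensorProdLeftTo C₁ C₂ A)`.
[cite: MacLane1963Homology, Ch. V (1.6)] [cite: DeligneHodgeII1971, 1.1.12] -/
def lTensorProdMorphism : Morphism (E.lTensor (C₁.prod C₂)) ((E.lTensor C₁).prod (E.lTensor C₂)) where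
  left := tensorProdLeftTo C₁ C₂ B
  mid := tensorProdLeftTo C₁ C₂ E.mhs
  right := tensorProdLeftTo C₁ C₂ A
  mid_inc := by
    change (tensorProdLeftTo C₁ C₂ E.mhs).toLinearMap ∘ₗ ((Hom.id (C₁.prod C₂)).tensorMap E.inc).toLinearMap =
      (Hom.prodMap ((Hom.id C₁).tensorMap E.inc) ((Hom.id C₂).tensorMap E.inc)).toLinearMap ∘ₗ
        (tensorProdLeftTo C₁ C₂ B).toLinearMap
    rw [← Hom.prodMap_id]
    exact congrArg Hom.toLinearMap (tensorProdLeftTo_comp_tensorMap_prodMap (Hom.id C₁) (Hom.id C₂) E.inc)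
  proj_mid := by
    change (Hom.prodMap ((Hom.id C₁).tensorMap E.proj) ((Hom.id C₂).tensorMap E.proj)).toLinearMap ∘ₗ
        (tensorProdLeftTo C₁ C₂ E.mhs).toLinearMap =
      (tensorProdLeftTo C₁ C₂ A).toLinearMap ∘ₗ ((Hom.id (C₁.prod C₂)).tensorMap E.proj).toLinearMap
    rw [← Hom.prodMap_id]
    exact congrArg Hom.toLinearMap (tensorProdLeftTo_comp_tensorMap_prodMap (Hom.id C₁) (Hom.id C₂) E.proj).symm

/-- Components of `lTensorProdMorphism` (by `rfl`). [cite: MacLane1963Homology, Ch. V (1.6)] -/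
@[simp]
theorem lTensorProdMorphism_left : (E.lTensorProdMorphism C₁ C₂).left = tensorProdLeftTo C₁ C₂ B := rfl

/-- Components of `lTensorProdMorphism` (by `rfl`). [cite: MacLane1963Homology, Ch. V (1.6)] -/
@[simp]
theorem lTensorProdMorphism_right : (E.lTensorProdMorphism C₁ C₂).right = tensorProdLeftTo C₁ C₂ A := rfl

/-- **`ζ_* [(C₁ ⊕ C₂) ⊗ E]_W = ζ^* [(C₁ ⊗ E) ⊕ (C₂ ⊗ E)]_W`.** [cite: MacLane1963Homology, Ch. III Prop. 1.8] -/
theorem postcomp_clsW_lTensor_prod :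
    JHomW.postcomp (tensor (C₁.prod C₂) A) (tensorProdLeftTo C₁ C₂ B) (E.lTensor (C₁.prod C₂)).clsW =
      JHomW.precomp ((tensor C₁ B).prod (tensor C₂ B)) (tensorProdLeftTo C₁ C₂ A)
        ((E.lTensor C₁).prod (E.lTensor C₂)).clsW :=
  (E.lTensorProdMorphism C₁ C₂).postcomp_clsW_eq_precomp_clsW

/-- **`ζ_* ((C₁ ⊕ C₂) ⊗ E) ≡ ζ^* ((C₁ ⊗ E) ⊕ (C₂ ⊗ E))`** as extensions. [cite: MacLane1963Homology, Ch. III Prop. 1.8] -/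
theorem nonempty_congruence_lTensor_prod :
    Nonempty (Congruence ((E.lTensor (C₁.prod C₂)).pushout (tensorProdLeftTo C₁ C₂ B))
      (((E.lTensor C₁).prod (E.lTensor C₂)).pullback (tensorProdLeftTo C₁ C₂ A))) :=
  nonempty_congruence_pushout_pullback_of_morphism (E.lTensorProdMorphism C₁ C₂)

/-- **`(C₁ ⊕ C₂) ⊗ E` splits iff `C₁ ⊗ E` and `C₂ ⊗ E` both split.** [cite: MacLane1963Homology, Ch. III Prop. 1.8] -/
theorem isSplit_lTensor_prod_iff :
    (E.lTensor (C₁.prod C₂)).IsSplit ↔ (E.lTensor C₁).IsSplit ∧ (E.lTensor C₂).IsSplit := by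
  rw [(E.lTensorProdMorphism C₁ C₂).isSplit_iff_of_bijective (tensorProdLeftTo_bijective C₁ C₂ B)
    (tensorProdLeftTo_bijective C₁ C₂ A), isSplit_prod_iff]

end Extension

namespace Ext

/-- **`ζ_* (x ⊗ (C₁ ⊕ C₂)) = ζ^* ((x ⊗ C₁) ⊕ (x ⊗ C₂))`** for every class `x ∈ Ext(A, B)`: right tensoring
of extension classes is additive in the MHS. [cite: MacLane1963Homology, Ch. III Prop. 1.8] [cite: Jannsen1990MixedMotives, §9 Remark 9.3 a)] -/
theorem pushoutMapW_rTensorMap_prod (x : Ext A B) :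
    pushoutMapW (tensorProdRightTo B C₁ C₂) (rTensorMap (C₁.prod C₂) x) =
      pullbackMapW (tensorProdRightTo A C₁ C₂) (prodW (rTensorMap C₁ x) (rTensorMap C₂ x)) := by
  obtain ⟨E, rfl⟩ := exists_mkOfW_eq x
  rw [rTensorMap_mkOfW, rTensorMap_mkOfW, rTensorMap_mkOfW, prodW_mkOfW]
  exact pushoutMapW_mkOfW_eq_pullbackMapW_mkOfW (E.rTensorProdMorphism C₁ C₂)

/-- **Transport form**: `ζ_* (ζ⁻¹)^* (x ⊗ (C₁ ⊕ C₂)) = (x ⊗ C₁) ⊕ (x ⊗ C₂)`.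
[cite: MacLane1963Homology, Ch. III Prop. 1.8] [cite: Jannsen1990MixedMotives, §9 Remark 9.3 a)] -/
theorem transport_rTensorMap_prod (x : Ext A B) :
    pushoutMapW (tensorProdRightTo B C₁ C₂)
        (pullbackMapW (tensorProdRightInv A C₁ C₂) (rTensorMap (C₁.prod C₂) x)) =
      prodW (rTensorMap C₁ x) (rTensorMap C₂ x) := by
  rw [pushoutMapW_pullbackMapW, pushoutMapW_rTensorMap_prod, ← pullbackMapW_comp,
    tensorProdRightTo_comp_tensorProdRightInv, pullbackMapW_id]

/-- **Solved for `x ⊗ (C₁ ⊕ C₂)`**: `x ⊗ (C₁ ⊕ C₂) = (ζ⁻¹)_* ζ^* ((x ⊗ C₁) ⊕ (x ⊗ C₂))`.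
[cite: MacLane1963Homology, Ch. III Prop. 1.8] [cite: Jannsen1990MixedMotives, §9 Remark 9.3 a)] -/
theorem rTensorMap_prod_eq (x : Ext A B) :
    rTensorMap (C₁.prod C₂) x =
      pushoutMapW (tensorProdRightInv B C₁ C₂)
        (pullbackMapW (tensorProdRightTo A C₁ C₂) (prodW (rTensorMap C₁ x) (rTensorMap C₂ x))) := by
  rw [← pushoutMapW_rTensorMap_prod, ← pushoutMapW_comp, tensorProdRightInv_comp_tensorProdRightTo,
    pushoutMapW_id]

/-- `x ⊗ (C₁ ⊕ C₂) = 0 ↔ x ⊗ C₁ = 0 ∧ x ⊗ C₂ = 0`. [cite: MacLane1963Homology, Ch. III Prop. 1.8] -/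
theorem rTensorMap_prod_eq_zeroW_iff (x : Ext A B) :
    rTensorMap (C₁.prod C₂) x = zeroW ↔ rTensorMap C₁ x = zeroW ∧ rTensorMap C₂ x = zeroW := by
  rw [← prodW_eq_zeroW_iff, ← transport_rTensorMap_prod,
    pushoutMapW_eq_zeroW_iff_of_bijective _ (tensorProdRightTo_bijective B C₁ C₂),
    pullbackMapW_eq_zeroW_iff_of_bijective _ (tensorProdRightInv_bijective A C₁ C₂)]

/-- **`ζ_* ((C₁ ⊕ C₂) ⊗ x) = ζ^* ((C₁ ⊗ x) ⊕ (C₂ ⊗ x))`**: left tensoring of extension classes is additive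
in the MHS. [cite: MacLane1963Homology, Ch. III Prop. 1.8] [cite: Jannsen1990MixedMotives, §9 Remark 9.3 a)] -/
theorem pushoutMapW_lTensorMap_prod (x : Ext A B) :
    pushoutMapW (tensorProdLeftTo C₁ C₂ B) (lTensorMap (C₁.prod C₂) x) =
      pullbackMapW (tensorProdLeftTo C₁ C₂ A) (prodW (lTensorMap C₁ x) (lTensorMap C₂ x)) := by
  obtain ⟨E, rfl⟩ := exists_mkOfW_eq x
  rw [lTensorMap_mkOfW, lTensorMap_mkOfW, lTensorMap_mkOfW, prodW_mkOfW]
  exact pushoutMapW_mkOfW_eq_pullbackMapW_mkOfW (E.lTensorProdMorphism C₁ C₂)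

/-- **Transport form**: `ζ_* (ζ⁻¹)^* ((C₁ ⊕ C₂) ⊗ x) = (C₁ ⊗ x) ⊕ (C₂ ⊗ x)`.
[cite: MacLane1963Homology, Ch. III Prop. 1.8] [cite: Jannsen1990MixedMotives, §9 Remark 9.3 a)] -/
theorem transport_lTensorMap_prod (x : Ext A B) :
    pushoutMapW (tensorProdLeftTo C₁ C₂ B)
        (pullbackMapW (tensorProdLeftInv C₁ C₂ A) (lTensorMap (C₁.prod C₂) x)) =
      prodW (lTensorMap C₁ x) (lTensorMap C₂ x) := by
  rw [pushoutMapW_pullbackMapW, pushoutMapW_lTensorMap_prod, ← pullbackMapW_comp,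
    tensorProdLeftTo_comp_tensorProdLeftInv, pullbackMapW_id]

/-- **Solved for `(C₁ ⊕ C₂) ⊗ x`**: `(C₁ ⊕ C₂) ⊗ x = (ζ⁻¹)_* ζ^* ((C₁ ⊗ x) ⊕ (C₂ ⊗ x))`.
[cite: MacLane1963Homology, Ch. III Prop. 1.8] [cite: Jannsen1990MixedMotives, §9 Remark 9.3 a)] -/
theorem lTensorMap_prod_eq (x : Ext A B) :
    lTensorMap (C₁.prod C₂) x =
      pushoutMapW (tensorProdLeftInv C₁ C₂ B)
        (pullbackMapW (tensorProdLeftTo C₁ C₂ A) (prodW (lTensorMap C₁ x) (lTensorMap C₂ x))) := by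
  rw [← pushoutMapW_lTensorMap_prod, ← pushoutMapW_comp, tensorProdLeftInv_comp_tensorProdLeftTo,
    pushoutMapW_id]

/-- `(C₁ ⊕ C₂) ⊗ x = 0 ↔ C₁ ⊗ x = 0 ∧ C₂ ⊗ x = 0`. [cite: MacLane1963Homology, Ch. III Prop. 1.8] -/
theorem lTensorMap_prod_eq_zeroW_iff (x : Ext A B) :
    lTensorMap (C₁.prod C₂) x = zeroW ↔ lTensorMap C₁ x = zeroW ∧ lTensorMap C₂ x = zeroW := by
  rw [← prodW_eq_zeroW_iff, ← transport_lTensorMap_prod,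
    pushoutMapW_eq_zeroW_iff_of_bijective _ (tensorProdLeftTo_bijective C₁ C₂ B),
    pullbackMapW_eq_zeroW_iff_of_bijective _ (tensorProdLeftInv_bijective C₁ C₂ A)]

end Ext

end TensorProd

end MixedHodgeStructure

end Literature.AlgebraicGeometry.Motives

end
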